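import Summits.ResolutionOfSingularities.ResolutionOfSingularities.Theorems.FrobeniusLadderFRationalResolutionGaloisSymmetrizedPiece
import Summits.ResolutionOfSingularities.ResolutionOfSingularities.Theorems.FrobeniusLadderFRationalResolutionBlowupAbsorbsCartier
import Summits.ResolutionOfSingularities.ResolutionOfSingularities.Theorems.FrobeniusLadderFRationalResolutionBlowupCartierBaseChange
import Summits.ResolutionOfSingularities.ResolutionOfSingularities.Theorems.FrobeniusLadderFRationalResolutionDescendedPrimaryPieceCover
import Summits.ResolutionOfSingularities.ResolutionOfSingularities.Theorems.FrobeniusLadderFRationalResolutionGaloisTwistChart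
import HarnessLib

/-!
# Crux `FrobeniusLadder.FRationalResolution` (stmt-ResolutionOfSingularities-15317), line `redirect`,
# stub `stub_diagonalizableQuotientResolution` — ONE-STOP FORM v2 of the Galois route's remaining obligation: the symmetrized piece
# has regular blow-up as soon as the CHART TWISTS `σ''(I₁ C')` are Cartier on the blow-up of the CHART CENTRE `J`

Assembly of `…GaloisSymmetrizedPiece` (✓p835018: hD by construction), `…BlowupAbsorbsCartier` (✓p835093), `…BlowupCartierBaseChange`
(✓p835409), `…DescendedPrimaryPieceCover` (✓p835651: Flat/Surjective instances and centre transport for the localized chart map) and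
`…GaloisTwistChart` (✓p835739: `((1 ⊗ σ) I₁) C' = σ''(I₁ C')`). Compared with `…GaloisSymmetrizedPieceRegular` (✓p835312), whose
hypothesis `htw` asks for principal generators of the twists on the Rees charts of `Bl_{I₁ B'_h}` (a blow-up of the NON-explicit
piece `I₁`), the hypothesis here lives on the étale chart: with the data of `…GaloisUpstairsPieceCover.exists_piece_cover` — `G` with
`I₁ C'_G = J C'_G` and `D(h) ⊆ im (Spec C'_G → Spec B')` — it asks, for every `σ` in the decomposition group of `𝔔'`, that the chart
twist `σ''(I₁ C')`, extended to `C'_{G h}`, be an effective Cartier divisor on `Bl_{J C'_{G h}}(Spec C'_{G h})`, the blow-up of the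
(monomial) chart centre `J`. Conclusion as before: `I = ∏_{σ ∈ D} (1 ⊗ σ)(I₁)` is `𝔔'`-primary, `⊆ I₁`, decomposition-stable, and
`Bl_{I B'_h}` is regular — the input `(I, m, hD, hreg)` of `…GaloisBaseChangeRegular.hloc_of_decomposition_stable_piece'`.

What remains after this file (memo MEMO-15317-leafhand2-g14): `σ''(I₁ C')` near the chart point `𝔚` is `I₁ C'` near the OTHER orbit
point `σ''⁻¹(𝔚)` transported by `σ''`; making it explicit is the comparison of the two monomial structures at one complete local ring.

* **`symmetrizedPiece_isRegular_affineBlowup_of_chart`** — the statement above.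

Honest label: plumbing toward ONE leaf stub (no stub, crux or summit closed). No definitions, no named facts, no sorry.
[cite: StacksProject, Tag 080A; Tag 09EB] [cite: GortzWedhorn2020, Prop. 13.91 (2)]
-/

noncomputable section

-- single-problem summit: the doubled namespace component is forced
set_option linter.dupNamespace false

open CategoryTheory AlgebraicGeometry
open scoped TensorProduct
open Literature.AlgebraicGeometry.Resolution
open Summit.ResolutionOfSingularities.ResolutionOfSingularities.Theorems.FRationalResolution

namespace Summit.ResolutionOfSingularities.ResolutionOfSingularities.Theorems.FRationalResolution.GaloisChartObligation

/-- **The symmetrized piece has regular blow-up when the chart twists are Cartier on the blow-up of the chart centre.** See the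
module docstring. `B' = B ⊗_K K'`, `C' = B' ⊗_B C`, `L = C'_G`, `L_h = C'_{G h}`; `σ'' = Algebra.TensorProduct.map (1 ⊗ σ) (id C)`.
[cite: StacksProject, Tag 080A; Tag 09EB] [cite: GortzWedhorn2020, Prop. 13.91 (2)] -/
theorem symmetrizedPiece_isRegular_affineBlowup_of_chart {K B K' C : Type} [Field K] [CommRing B] [Algebra K B] [Field K']
    [Algebra K K'] [FiniteDimensional K K'] [CommRing C] [Algebra B C] [Module.Flat B C]
    [IsNoetherianRing (B ⊗[K] K')]
    (𝔔' : Ideal (B ⊗[K] K')) (I₁ : Ideal (B ⊗[K] K')) {n : ℕ} (hn : 𝔔' ^ n ≤ I₁) (h₁ : I₁ ≤ 𝔔') (h : B ⊗[K] K')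
    (hreg₁ : Scheme.IsRegular (affineBlowup (I₁.map (algebraMap (B ⊗[K] K') (Localization.Away h)))))
    (J : Ideal C) (G : (B ⊗[K] K') ⊗[B] C)
    (hIJ : I₁.map (algebraMap (B ⊗[K] K') (Localization.Away G)) =
      (J.map ((Algebra.TensorProduct.includeRight : C →ₐ[B] (B ⊗[K] K') ⊗[B] C) : C →+* (B ⊗[K] K') ⊗[B] C)).map
        (algebraMap ((B ⊗[K] K') ⊗[B] C) (Localization.Away G)))
    (hsub : (PrimeSpectrum.basicOpen h : Set (PrimeSpectrum (B ⊗[K] K'))) ⊆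
      Set.range (PrimeSpectrum.comap (algebraMap (B ⊗[K] K') (Localization.Away G))))
    (htw : ∀ σ : K' ≃ₐ[K] K',
      𝔔'.map (Algebra.TensorProduct.map (AlgHom.id B B) (σ : K' →ₐ[K] K')) = 𝔔' →
      IsEffectiveCartier ((affineBlowup.idealSheaf
        ((((I₁.map (algebraMap (B ⊗[K] K') ((B ⊗[K] K') ⊗[B] C))).map
            (Algebra.TensorProduct.map (Algebra.TensorProduct.map (AlgHom.id B B) (σ : K' →ₐ[K] K'))
              (AlgHom.id B C))).map
            (algebraMap ((B ⊗[K] K') ⊗[B] C) (Localization.Away G))).map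
          (algebraMap (Localization.Away G)
            (Localization.Away (algebraMap (B ⊗[K] K') (Localization.Away G) h))))).comap
        (affineBlowup.π
          (((J.map ((Algebra.TensorProduct.includeRight : C →ₐ[B] (B ⊗[K] K') ⊗[B] C) :
              C →+* (B ⊗[K] K') ⊗[B] C)).map (algebraMap ((B ⊗[K] K') ⊗[B] C) (Localization.Away G))).map
            (algebraMap (Localization.Away G)
              (Localization.Away (algebraMap (B ⊗[K] K') (Localization.Away G) h))))))) :
    ∃ (I : Ideal (B ⊗[K] K')) (m : ℕ), 𝔔' ^ m ≤ I ∧ I ≤ 𝔔' ∧ I ≤ I₁ ∧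
      (∀ τ : K' ≃ₐ[K] K', 𝔔'.map (Algebra.TensorProduct.map (AlgHom.id B B) (τ : K' →ₐ[K] K')) = 𝔔' →
        I.map (Algebra.TensorProduct.map (AlgHom.id B B) (τ : K' →ₐ[K] K')) ≤ I) ∧
      Scheme.IsRegular (affineBlowup (I.map (algebraMap (B ⊗[K] K') (Localization.Away h)))) := by
  classical
  obtain ⟨D, m, hmemD, hQm, hleI₁, hleQ, hstab⟩ :=
    GaloisSymmetrizedPiece.exists_decomposition_stable_piece 𝔔' I₁ hn h₁
  set tw : (K' ≃ₐ[K] K') → Ideal (B ⊗[K] K') :=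
    fun σ => I₁.map (Algebra.TensorProduct.map (AlgHom.id B B) (σ : K' →ₐ[K] K')) with htwdef
  refine ⟨∏ σ ∈ D, tw σ, m, hQm, hleQ, hleI₁, fun τ hτ => (hstab τ hτ).le, ?_⟩
  -- the localized symmetrized piece is the product of the localized twists
  set loc := algebraMap (B ⊗[K] K') (Localization.Away h) with hloc
  have hprod : (∏ σ ∈ D, tw σ).map loc = ∏ σ ∈ D, (tw σ).map loc := by
    have := map_prod (Ideal.mapHom loc) tw D
    simpa only [Ideal.mapHom_apply] using this
  rw [hprod]
  -- the factor at `σ = 1` is `I₁ B'_h`, whose blow-up is regular; the other twists are Cartier on it, checked on the chart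
  have hone : (1 : K' ≃ₐ[K] K') ∈ D := by
    rw [hmemD, GaloisSymmetrizedPiece.twist_one]
    exact Ideal.map_id _
  have htw1 : (tw 1).map loc = I₁.map loc := by
    simp only [htwdef, GaloisSymmetrizedPiece.twist_one]
    exact congrArg (Ideal.map loc) (Ideal.map_id _)
  refine BlowupAbsorbsCartier.affineBlowup_prod_isRegular_of_isEffectiveCartier' D (fun σ => (tw σ).map loc) hone
    (by rw [htw1]; exact hreg₁) fun σ hσ => ?_
  rw [htw1]
  -- base change along the flat surjective localized chart map `B'_h → C'_{G h}`
  set L := Localization.Away G with hL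
  set Lh := Localization.Away (algebraMap (B ⊗[K] K') L h) with hLh
  set φ : Localization.Away h →+* Lh := IsLocalization.Away.map (Localization.Away h) Lh (algebraMap (B ⊗[K] K') L) h
    with hφ
  haveI := DescendedPrimaryPieceCover.flat_specMap_awayMap (B := B ⊗[K] K') (C := L) h (Localization.Away h) Lh
  haveI := DescendedPrimaryPieceCover.surjective_specMap_awayMap (B := B ⊗[K] K') (C := L) h hsub (Localization.Away h) Lh
  refine BlowupCartierBaseChange.isEffectiveCartier_comap_affineBlowup_of_flat_surjective φ (I₁.map loc) ((tw σ).map loc) ?_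
  have htwL : (tw σ).map (algebraMap (B ⊗[K] K') L) =
      ((I₁.map (algebraMap (B ⊗[K] K') ((B ⊗[K] K') ⊗[B] C))).map
          (Algebra.TensorProduct.map (Algebra.TensorProduct.map (AlgHom.id B B) (σ : K' →ₐ[K] K'))
            (AlgHom.id B C))).map
        (algebraMap ((B ⊗[K] K') ⊗[B] C) L) := by
    rw [htwdef, GaloisTwistChart.map_chartTwist_map_algebraMap, Ideal.map_map,
      ← IsScalarTower.algebraMap_eq (B ⊗[K] K') ((B ⊗[K] K') ⊗[B] C) L]
  rw [hloc, DescendedPrimaryPieceCover.map_awayMap_eq h (Localization.Away h) Lh I₁ _ hIJ,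
    DescendedPrimaryPieceCover.map_awayMap_eq h (Localization.Away h) Lh (tw σ) _ htwL]
  exact htw σ ((hmemD σ).mp hσ)

end Summit.ResolutionOfSingularities.ResolutionOfSingularities.Theorems.FRationalResolution.GaloisChartObligation

end
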